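import Literature.Analysis.FluidPDE.PressureFreeEpsilonRegularity
import Summits.NavierStokesRegularity.NavierStokesRegularity.Theorems.SelfMixingDichotomySequentialTypeIExclusionStructure
import HarnessLib

/-!
# Crux `SelfMixingDichotomy.SequentialTypeIExclusion` (stmt-NavierStokesRegularity-1424), line
  `registered`: the SMALL-REYNOLDS-NUMBER corner of the crux

The crux S1 says: for every `M`, every classical Leray–Hopf solution `u` (ν = 1) of Navier–Stokes on
`ℝ³ × [0, T)` from a rapidly decaying datum and every `x₀`, Type-I WINDOWS `C(r; T, x₀) ≤ M` at
arbitrarily small scales (`C = Literature.Analysis.FluidPDE.cknC`, backward cylinders `Q_r(T, x₀)`)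
force `u` to be bounded on some `(T − ρ², T) × B_ρ(x₀)`. Its informal text records that the case of
SMALL `M` is known mathematics — the ONE-SCALE ε-regularity criterion in terms of the velocity alone
(Wolf 2015; Chae–Wolf 2017; Wang–Wu–Zhou 2019; Kwon 2023) — and that the content of the crux is
`M ≥ ε`. The leads 0–c3 of this line landed every other provable corner; this file machine-checks the
small-`M` corner:

* `Literature.Analysis.FluidPDE.kwon2023_velocity_epsilon_regularity` (filed by this lead, p164738,
  `Literature/Analysis/FluidPDE/PressureFreeEpsilonRegularity.lean`) — the NAMED FACT (H. Kwon, J. Differential Equations 2023 =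
  arXiv:2104.03160, Thm. 1.4 with `r = m = 3`, for suitable weak solutions in the sense of
  Scheffer / Caffarelli–Kohn–Nirenberg / Lin, which the source notes are dissipative weak solutions,
  §1 p. 3): an absolute `ε > 0` such that a suitable weak solution `(u, p)` of Navier–Stokes
  (ν = 1, no force) on a backward cylinder `Q_r(z₀)` with `u ∈ L^∞_t L²_x(Q_r)`, `∇u ∈ L²(Q_r)`,
  `p ∈ L^{3/2}(Q_r)` and `r⁻² ∬_{Q_r(z₀)} |u|³ ≤ ε` is essentially bounded on `Q_{r/4}(z₀)` — NO
  smallness of the pressure. The tree has the pressure-ful one-scale criterion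
  (`unforced_epsilonRegularity_of_theorem15_3`, `lemarieRieusset_epsilon_regularity`) and the
  all-scales velocity criterion at a top point (`exists_bound_near_top_of_classical_of_tendsto_cknC`,
  Gustafson–Kang–Tsai), but not the pressure-free one-scale criterion (cf. the module docstring of
  `Literature/Analysis/FluidPDE/ChaeWolfDSSDecayL3.lean`), whose printed proofs need Wolf's local
  pressure projection / Kwon's local Leray projection (steady Stokes theory on bounded domains).
* `sequentialTypeIExclusion_of_small` — **the small-`M` corner of S1**, conditional on that fact:
  there is `ε₀ > 0` such that S1 holds verbatim for every `M ≤ ε₀`. Proof: gauge the pressure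
  (`SereginSverak2002.isSuitableWeakSolutionOn_gauge_of_classical`: `(u, q)` is suitable on the open
  slab `(0, T) × ℝ³`, `q ∈ L^{3/2}` of the slab by `…lintegral_slab_gauged_pressure_lt_top`); a window
  `C(r; T, x₀) ≤ M ≤ ε₀` with `r² < T` puts `Q_r(T, x₀)` inside the slab; the energy class of the
  Leray–Hopf solution gives `A_ess(r) < ∞`, `E(r) < ∞` (`IsLerayHopfOn.exists_hasWeakSpatialGradientOn`,
  `SereginSverak2002.eEnergy_le`); the fact gives essential boundedness on `Q_{r/4}(T, x₀)`, which is a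
  pointwise bound because `u` is continuous below `T`
  (`SereginSverak2002.norm_le_of_ae_restrict_of_continuousOn`).

* `windowsForceTypeI_of_small` — the same corner of the open stub `stub_windowsForceTypeI` (no
  scale-intermittency): for `M ≤ ε₀` the windows force boundedness, and a bounded field has
  `C(r; T, x₀) = O(r³)` (`cknC_typeIBound_of_bdd`, `…Structure.lean`), hence a centred Type-I bound.

Landed `--supports stmt-NavierStokesRegularity-1424` as the registered sub-goal
`sequentialTypeIExclusion_of_small` (for `M ≤ ε₀` it bypasses both open stubs
`stub_windowsForceTypeI` / `stub_noTypeISingularity`; it is not part of the skeleton's composition,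
which needs every `M`).
-/

noncomputable section

-- the summit and its single problem share the name (D-0017 nested layout)
set_option linter.dupNamespace false

namespace Summit.NavierStokesRegularity.NavierStokesRegularity.Theorems.SequentialTypeIExclusion.Registered

open scoped ENNReal NNReal Topology
open Literature.Analysis.FluidPDE Set Filter MeasureTheory Function Metric

/-- The backward cylinder `Q_r(T, x₀)` with `r² ≤ T` lies in the slab `(0, T) × ℝ³`. [folklore] -/
private theorem parabolicCylinder_subset_slab' {T r : ℝ} (hr : r ^ 2 ≤ T)
    (x₀ : EuclideanSpace ℝ (Fin 3)) :
    parabolicCylinder r ((T, x₀) : ℝ × EuclideanSpace ℝ (Fin 3)) ⊆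
      Ioo 0 T ×ˢ (univ : Set (EuclideanSpace ℝ (Fin 3))) := by
  intro w hw
  simp only [mem_parabolicCylinder] at hw
  exact ⟨⟨by linarith [hw.1.1], hw.1.2⟩, mem_univ _⟩

/-- `D(r; z) < ∞` when `Q_r(z)` lies in a set over which `|q|^{3/2}` is integrable. [folklore] -/
private theorem cknD_lt_top_of_subset {r : ℝ} (hr : 0 < r) {z : ℝ × EuclideanSpace ℝ (Fin 3)}
    {S : Set (ℝ × EuclideanSpace ℝ (Fin 3))} {q : ℝ → EuclideanSpace ℝ (Fin 3) → ℝ}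
    (hint : ∫⁻ w in S, ‖q w.1 w.2‖ₑ ^ (3 / 2 : ℝ) < ∞) (hS : parabolicCylinder r z ⊆ S) :
    cknD r z q < ⊤ := by
  rw [cknD]
  exact ENNReal.mul_lt_top
    (ENNReal.inv_lt_top.2 (ENNReal.pow_pos (ENNReal.ofReal_pos.2 hr) _))
    (lt_of_le_of_lt (lintegral_mono_set hS) hint)

/-- `E(r; z) < ∞` when `Q_r(z)` lies in a set over which `|G|²` is integrable. [folklore] -/
private theorem cknE_lt_top_of_subset {r : ℝ} (hr : 0 < r) {z : ℝ × EuclideanSpace ℝ (Fin 3)}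
    {S : Set (ℝ × EuclideanSpace ℝ (Fin 3))}
    {G : ℝ → EuclideanSpace ℝ (Fin 3) → EuclideanSpace ℝ (Fin 3) →L[ℝ] EuclideanSpace ℝ (Fin 3)}
    (hint : ∫⁻ w in S, ENNReal.ofReal (frobeniusNormSq (G w.1 w.2)) < ∞)
    (hS : parabolicCylinder r z ⊆ S) : cknE r z G < ⊤ := by
  rw [cknE]
  exact ENNReal.mul_lt_top (ENNReal.inv_lt_top.2 (ENNReal.ofReal_pos.2 hr))
    (lt_of_le_of_lt (lintegral_mono_set hS) hint)

/-- `A_ess(r; T, x₀) < ∞` when the energy `∫ |u(t)|²` is bounded for `T - r² < t < T`. [folklore] -/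
private theorem cknAEss_lt_top_of_eEnergy_le {T r : ℝ} (hr : 0 < r)
    {x₀ : EuclideanSpace ℝ (Fin 3)}
    {u : ℝ → EuclideanSpace ℝ (Fin 3) → EuclideanSpace ℝ (Fin 3)} {K : ℝ≥0∞} (hK : K ≠ ∞)
    (hE : ∀ t ∈ Ioo (T - r ^ 2) T, eEnergy (u t) ≤ K) :
    cknAEss r ((T, x₀) : ℝ × EuclideanSpace ℝ (Fin 3)) u < ⊤ := by
  refine lt_of_le_of_lt ?_ (ENNReal.mul_lt_top (ENNReal.inv_lt_top.2 (ENNReal.ofReal_pos.2 hr))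
    hK.lt_top)
  rw [cknAEss]
  refine essSup_le_of_ae_le _ ?_
  filter_upwards [ae_restrict_mem measurableSet_Ioo] with t ht
  gcongr
  exact (setLIntegral_le_lintegral _ _).trans (hE t ht)

/-- **The small-Reynolds-number corner of the crux S1** (known mathematics, conditional on the
published pressure-free one-scale ε-regularity criterion `kwon2023_velocity_epsilon_regularity`,
Kwon 2023 Thm. 1.4 / Wolf 2015): there is an absolute `ε₀ > 0` such that for every `M ≤ ε₀`, every
classical Leray–Hopf solution `u` (ν = 1) of Navier–Stokes on `ℝ³ × [0, T)` from a rapidly decaying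
datum and every `x₀`, Type-I windows `C(r; T, x₀) ≤ M` at arbitrarily small scales (indeed ONE window
`C(r; T, x₀) ≤ M` with `r² < T`) force `u` to be bounded on some `(T − ρ², T) × B_ρ(x₀)`. This is the
statement of `SelfMixingDichotomy.SequentialTypeIExclusion` restricted to `M ≤ ε₀`; the content of
the crux is `M > ε₀` (no scale-intermittency ∧ centred Type-I exclusion, both open). -/
theorem sequentialTypeIExclusion_of_small :
    Literature.Analysis.FluidPDE.kwon2023_velocity_epsilon_regularity →
    ∃ ε₀ : ℝ, 0 < ε₀ ∧ ∀ M : ℝ, M ≤ ε₀ → ∀ T : ℝ, 0 < T →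
      ∀ (u : ℝ → EuclideanSpace ℝ (Fin 3) → EuclideanSpace ℝ (Fin 3))
        (p : ℝ → EuclideanSpace ℝ (Fin 3) → ℝ),
        Literature.Analysis.FluidPDE.IsClassicalNSSolutionOn (Set.Ico 0 T) 1 0 u p →
        Literature.Analysis.FluidPDE.IsLerayHopfOn T 1 0 (u 0) u →
        Literature.Analysis.FluidPDE.HasRapidSpatialDecay (u 0) →
        ∀ x₀ : EuclideanSpace ℝ (Fin 3),
          (∀ r₀ : ℝ, 0 < r₀ → ∃ r ∈ Set.Ioo 0 r₀,
            Literature.Analysis.FluidPDE.cknC r ((T, x₀) : ℝ × EuclideanSpace ℝ (Fin 3)) u ≤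
              ENNReal.ofReal M) →
          ∃ ρ : ℝ, 0 < ρ ∧ ∃ M : ℝ, ∀ t ∈ Set.Ioo (T - ρ ^ 2) T, ∀ x ∈ Metric.ball x₀ ρ,
            ‖u t x‖ ≤ M := by
  rintro ⟨ε, hε, H⟩
  refine ⟨ε, hε, ?_⟩
  rintro M hM T hT u p hcl hLH - x₀ hwin
  -- ### Step 1: the gauged suitable weak solution on the slab `(0, T) × ℝ³`
  set q : ℝ → EuclideanSpace ℝ (Fin 3) → ℝ :=
    fun t x => p t x - (p t 0 - normalisedPressure (u t) 0) with hq
  have hsw : IsSuitableWeakSolutionOn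
      (slab (EuclideanSpace ℝ (Fin 3)) (Ioo 0 T) isOpen_Ioo) 1 0 u q :=
    SereginSverak2002.isSuitableWeakSolutionOn_gauge_of_classical one_pos hT hcl hLH _
      (coe_slab _ _).subset
  obtain ⟨G, hG, -, hGint, -⟩ := hLH.exists_hasWeakSpatialGradientOn
  have hqint : ∫⁻ w in Ioo 0 T ×ˢ (univ : Set (EuclideanSpace ℝ (Fin 3))),
      ‖q w.1 w.2‖ₑ ^ (3 / 2 : ℝ) < ∞ :=
    SereginSverak2002.lintegral_slab_gauged_pressure_lt_top one_pos hT hcl hLH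
  -- ### Step 2: a window `C(r; T, x₀) ≤ M ≤ ε` at a scale `r < √T`
  obtain ⟨r, hr, hCr⟩ := hwin (Real.sqrt T) (Real.sqrt_pos.2 hT)
  have hr0 : 0 < r := hr.1
  have hrT : r ^ 2 ≤ T := by
    calc r ^ 2 ≤ Real.sqrt T ^ 2 := pow_le_pow_left₀ hr0.le hr.2.le 2
      _ = T := Real.sq_sqrt hT.le
  have hsub0 : parabolicCylinder r ((T, x₀) : ℝ × EuclideanSpace ℝ (Fin 3)) ⊆
      Ioo 0 T ×ˢ (univ : Set (EuclideanSpace ℝ (Fin 3))) :=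
    parabolicCylinder_subset_slab' hrT x₀
  have hle : parabolicCylinderOpens r ((T, x₀) : ℝ × EuclideanSpace ℝ (Fin 3)) ≤
      slab (EuclideanSpace ℝ (Fin 3)) (Ioo 0 T) isOpen_Ioo := by
    rw [← SetLike.coe_subset_coe, coe_parabolicCylinderOpens, coe_slab]
    exact hsub0
  -- the pair restricted to the open cylinder `Q_r(T, x₀)`
  have hswQ : IsSuitableWeakSolutionOn
      (parabolicCylinderOpens r ((T, x₀) : ℝ × EuclideanSpace ℝ (Fin 3))) 1 0 u q :=
    hsw.of_le hle
  -- the three global classes on the cylinder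
  have hA : cknAEss r ((T, x₀) : ℝ × EuclideanSpace ℝ (Fin 3)) u < ⊤ := by
    refine cknAEss_lt_top_of_eEnergy_le hr0
      (K := ENNReal.ofReal (2 * VectorCalculus.kineticEnergy (u 0))) ENNReal.ofReal_ne_top
      fun t ht => ?_
    exact SereginSverak2002.eEnergy_le zero_le_one hLH ⟨by linarith [ht.1], ht.2.le⟩
  have hE : ∃ G' : ℝ → EuclideanSpace ℝ (Fin 3) →
      EuclideanSpace ℝ (Fin 3) →L[ℝ] EuclideanSpace ℝ (Fin 3),
      HasWeakSpatialGradientOn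
          (parabolicCylinderOpens r ((T, x₀) : ℝ × EuclideanSpace ℝ (Fin 3))) u G' ∧
        cknE r ((T, x₀) : ℝ × EuclideanSpace ℝ (Fin 3)) G' < ⊤ :=
    ⟨G, hG.mono hle, cknE_lt_top_of_subset hr0 hGint hsub0⟩
  have hD : cknD r ((T, x₀) : ℝ × EuclideanSpace ℝ (Fin 3)) q < ⊤ :=
    cknD_lt_top_of_subset hr0 hqint hsub0
  have hC : cknC r ((T, x₀) : ℝ × EuclideanSpace ℝ (Fin 3)) u ≤ ENNReal.ofReal ε :=
    hCr.trans (ENNReal.ofReal_le_ofReal hM)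
  -- ### Step 3: the pressure-free ε-regularity criterion on `Q_r(T, x₀)`
  have hfin : eLpNorm (uncurry u) ∞ (volume.restrict
      (parabolicCylinder (r / 4) ((T, x₀) : ℝ × EuclideanSpace ℝ (Fin 3)))) ≠ ∞ :=
    (H u q _ r hr0 hswQ hA hE hD hC).ne
  -- ### Step 4: essential boundedness on a cylinder below `T` is a pointwise bound
  set ρ : ℝ := r / 4 with hρ_def
  have hρ : 0 < ρ := by positivity
  have hρr : ρ ≤ r := by rw [hρ_def]; linarith
  have hρT : ρ ^ 2 ≤ T := (pow_le_pow_left₀ hρ.le hρr 2).trans hrT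
  have hae : ∀ᵐ w ∂(volume.restrict (parabolicCylinder ρ ((T, x₀) : ℝ × EuclideanSpace ℝ (Fin 3)))),
      ‖uncurry u w‖ ≤ (eLpNorm (uncurry u) ∞ (volume.restrict
        (parabolicCylinder ρ ((T, x₀) : ℝ × EuclideanSpace ℝ (Fin 3))))).toReal := by
    have h1 := ae_le_eLpNormEssSup (μ := volume.restrict
      (parabolicCylinder ρ ((T, x₀) : ℝ × EuclideanSpace ℝ (Fin 3)))) (f := uncurry u)
    rw [eLpNorm_exponent_top] at hfin ⊢
    filter_upwards [h1] with w hw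
    exact (toReal_enorm (uncurry u w)) ▸ ENNReal.toReal_mono hfin hw
  have hcont : ContinuousOn (uncurry u)
      (parabolicCylinder ρ ((T, x₀) : ℝ × EuclideanSpace ℝ (Fin 3))) :=
    (SereginSverak2002.continuousOn_uncurry hcl).mono
      ((parabolicCylinder_subset_slab' hρT x₀).trans (prod_mono Ioo_subset_Ico_self Subset.rfl))
  have hall := SereginSverak2002.norm_le_of_ae_restrict_of_continuousOn
    (isOpen_parabolicCylinder ρ _) hcont hae
  refine ⟨ρ, hρ, _, fun t ht x hx => hall (t, x) ?_⟩
  rw [mem_parabolicCylinder]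
  exact ⟨⟨ht.1, ht.2⟩, mem_ball.1 hx⟩

/-- **The small-Reynolds-number corner of the open stub `stub_windowsForceTypeI` (no
scale-intermittency)**, conditional on `kwon2023_velocity_epsilon_regularity`: there is `ε₀ > 0`
such that for `M ≤ ε₀`, Type-I windows `C(r; T, x₀) ≤ M` at arbitrarily small scales force a centred
cubic Type-I bound `C(r; T, x₀) ≤ M'` for all `0 < r < r₁` — because they force boundedness of `u`
near `(T, x₀)` (`sequentialTypeIExclusion_of_small`) and a bounded field has `C(r) = O(r³)`
(`cknC_typeIBound_of_bdd`). The open content of the stub is `M > ε₀` with SPARSE windows. -/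
theorem windowsForceTypeI_of_small :
    Literature.Analysis.FluidPDE.kwon2023_velocity_epsilon_regularity →
    ∃ ε₀ : ℝ, 0 < ε₀ ∧ ∀ M : ℝ, M ≤ ε₀ → ∀ T : ℝ, 0 < T →
      ∀ (u : ℝ → EuclideanSpace ℝ (Fin 3) → EuclideanSpace ℝ (Fin 3))
        (p : ℝ → EuclideanSpace ℝ (Fin 3) → ℝ),
        Literature.Analysis.FluidPDE.IsClassicalNSSolutionOn (Set.Ico 0 T) 1 0 u p →
        Literature.Analysis.FluidPDE.IsLerayHopfOn T 1 0 (u 0) u →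
        Literature.Analysis.FluidPDE.HasRapidSpatialDecay (u 0) →
        ∀ x₀ : EuclideanSpace ℝ (Fin 3),
          (∀ r₀ : ℝ, 0 < r₀ → ∃ r ∈ Set.Ioo 0 r₀,
            Literature.Analysis.FluidPDE.cknC r ((T, x₀) : ℝ × EuclideanSpace ℝ (Fin 3)) u ≤
              ENNReal.ofReal M) →
          ∃ M' : ℝ, ∃ r₁ : ℝ, 0 < r₁ ∧ ∀ r ∈ Set.Ioo 0 r₁,
            Literature.Analysis.FluidPDE.cknC r ((T, x₀) : ℝ × EuclideanSpace ℝ (Fin 3)) u ≤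
              ENNReal.ofReal M' := by
  intro hK
  obtain ⟨ε₀, hε₀, H⟩ := sequentialTypeIExclusion_of_small hK
  refine ⟨ε₀, hε₀, fun M hM T hT u p hcl hLH hdec x₀ hwin => ?_⟩
  obtain ⟨ρ, hρ, N, hN⟩ := H M hM T hT u p hcl hLH hdec x₀ hwin
  exact cknC_typeIBound_of_bdd hρ hN

end Summit.NavierStokesRegularity.NavierStokesRegularity.Theorems.SequentialTypeIExclusion.Registered

end
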